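import Summits.CriticalPhenomena.PercolationContinuityZ3.Theorems.PercTreeValueEquilateralAntiFactorisationFlowCertificate
import HarnessLib

/-!
# `EquilateralAntiFactorisation` (stmt-CriticalPhenomena-7800): the typed split
# crux ⟸ ThreePointAmplitudeLimit ∧ NonSaturation, and what the route actually needs

Strategist bookkeeping for the crux `PercTreeValue.EquilateralAntiFactorisation`
(`∃ δ > 0, r₀: ∀ r ≥ r₀, (1+δ) τ(0,a_r) τ(a_r,b_r) τ(b_r,0) ≤ P_{p_c}(0 ↔ a_r ∧ 0 ↔ b_r)²`, i.e.
`R_r(p_c)² ≥ 1 + δ` eventually, with `R_r(p)² = P_p(0 ↔ a_r ∧ 0 ↔ b_r)² / (τ τ τ)` the squared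
Delfino–Viti / Gladkov three-point ratio of the equilateral lattice triangle `{0, a_r, b_r}`,
`a_r = (r,r,0)`, `b_r = (r,0,r)`).

* `critRatioSq r` — the real sequence `R_r(p_c)²` (the expression of `Flow.infLogRatio_coe` at
  `p = p_c`, so that `Flow.infLogRatio r p_c = log (critRatioSq r)`);
* `NonSaturation` — `R_r(p_c)²` does NOT converge to its tree / jump value `1`
  (no sign, no uniform margin: `liminf < 1`, `limsup > 1` along a subsequence, or oscillation);
* `ThreePointAmplitudeLimit` — the critical three-point amplitude of `ℤ³` exists and is at least
  the tree value: `∃ ρ ≥ 1, R_r(p_c)² → ρ` (jump-CONSISTENT: in a jump world `ρ = 1`);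
* `EquilateralAntiFactorisation_of_subs : ThreePointAmplitudeLimit → NonSaturation → crux`
  (the glue of the split: `ρ ≠ 1`, `ρ ≥ 1` ⟹ `ρ > 1` ⟹ `R_r² ≥ (1+ρ)/2` eventually);
* `nonSaturation_of_EquilateralAntiFactorisation` — the crux implies `NonSaturation`;
* `tendsto_critRatioSq_of_theta_ne_zero` — in a jump world (`θ(p_c) ≠ 0`) the ratio saturates,
  `R_r(p_c)² → 1` (pattern-blindness `connectionPatternFactorisation_proof` at `p = p_c`, exactly as
  the anchor `stub_anchor` does it at `p > p_c`);
* `percolationContinuityZ3_of_nonSaturation : NonSaturation → PercolationContinuityZ3` — the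
  route needs only the weaker child: the sign `> 1` and the uniform `δ` of the crux are not used by
  its assembly (re-derivation, from landed theorems only, of the planner note P1 of
  `Cruxes/EquilateralAntiFactorisation/NEGATIVE-r2-k5.md`, independently checked by the two round-2
  triagers in scratch files `P1Check.lean` / `W.lean`).

Nothing here attacks the crux: `NonSaturation` is false in every jump world (it implies the
conjunct), and any proof of it by one-sided estimates must still separate `R_r(p_c)` from `1`
quantitatively (the budget obstruction N1 of the crux notes applies verbatim). The split records
the over-specification of the crux and isolates its jump-consistent part.
-/

noncomputable section

namespace Summit.CriticalPhenomena.PercolationContinuityZ3.Theorems.EquilateralAntiFactorisation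

open MeasureTheory Filter Topology
open Literature.Probability.Percolation Literature.Probability.LatticeModels
open Summit.CriticalPhenomena.PercolationContinuityZ3.Theses.PercTreeValue (EquilateralAntiFactorisation)

/-- `R_r(p_c)²`: the squared Delfino–Viti ratio of the equilateral lattice triangle at
criticality, `P_{p_c}(0 ↔ a_r ∧ 0 ↔ b_r)² / (τ(0,a_r) τ(a_r,b_r) τ(b_r,0))`. [folklore] -/
def critRatioSq (r : ℕ) : ℝ :=
  (bondPercolation (zdGraph 3) (criticalProbI 3)).real
      (openConn (0 : Site 3) ![(r : ℤ), (r : ℤ), 0] ∩ openConn (0 : Site 3) ![(r : ℤ), 0, (r : ℤ)]) ^ 2 /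
    (tau 3 (criticalProbI 3) 0 ![(r : ℤ), (r : ℤ), 0] *
      tau 3 (criticalProbI 3) ![(r : ℤ), (r : ℤ), 0] ![(r : ℤ), 0, (r : ℤ)] *
      tau 3 (criticalProbI 3) ![(r : ℤ), 0, (r : ℤ)] 0)

/-- **Sub-crux `NonSaturation`.** The critical three-point amplitude of `ℤ³` does not converge
to its tree (= jump-world) value: `¬ (R_r(p_c)² → 1)`. Strictly weaker than the crux (no sign, no
uniform margin); false in every jump world, hence conjunct-implying
(`percolationContinuityZ3_of_nonSaturation`). Stated as the planner note P1 of the crux workfile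
`Cruxes/EquilateralAntiFactorisation/NEGATIVE-r2-k5.md` (crux chain of stmt-CriticalPhenomena-7800); the
ratio is that of Delfino–Viti (doi:10.1088/1751-8113/44/3/032001) / Gladkov 2024 (arXiv:2408.08457,
Thm 1.1). [difficulty: open-problem]
[cite: Gladkov2024, Thm 1.1 and §6.3 (the ratio P(abc)/√(P(ab)P(ac)P(bc)); 1.022 in 2D)] -/
@[conjecture] def NonSaturation : Prop :=
  ¬ Tendsto critRatioSq atTop (𝓝 1)

/-- **Sub-crux `ThreePointAmplitudeLimit`.** The critical three-point amplitude `R*²` of `ℤ³`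
exists and is at least the tree value: `∃ ρ ≥ 1, R_r(p_c)² → ρ`. Jump-consistent (`ρ = 1` in a
jump world); numerically `ρ ≈ 1.12` (kit j019881, lead c2 of the crux chain). Existence of the limit
is the lattice form of "the continuum three-point structure constant `C₃` of (II.1.20) is
well-defined" (Hutchcroft 2025, arXiv:2508.18808, §II.1.4). [difficulty: open-problem]
[cite: Hutchcroft2025, §II.1.4 (II.1.20) (continuum three-point constant C₃)] -/
@[conjecture] def ThreePointAmplitudeLimit : Prop :=
  ∃ ρ : ℝ, 1 ≤ ρ ∧ Tendsto critRatioSq atTop (𝓝 ρ)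

/-! ### Positivity of the denominator at `p_c` -/

namespace Split

/-- `P_{p_c}(0 ↔ a_r ∧ 0 ↔ b_r) > 0`. -/
theorem threePoint_pos (r : ℕ) :
    0 < (bondPercolation (zdGraph 3) (criticalProbI 3)).real
      (openConn (0 : Site 3) ![(r : ℤ), (r : ℤ), 0] ∩ openConn (0 : Site 3) ![(r : ℤ), 0, (r : ℤ)]) := by
  have h := Flow.infT_pos r Flow.pc_pos Flow.pc_lt_one.le
  rw [Flow.mu_coe] at h
  exact h

/-- `τ_{p_c}(0, a_r) > 0`. -/
theorem tauA_pos (r : ℕ) : 0 < tau 3 (criticalProbI 3) 0 ![(r : ℤ), (r : ℤ), 0] := by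
  rw [tau_def]
  exact (threePoint_pos r).trans_le (measureReal_mono Set.inter_subset_left)

/-- `τ_{p_c}(a_r, b_r) > 0`. -/
theorem tauB_pos (r : ℕ) : 0 < tau 3 (criticalProbI 3) ![(r : ℤ), (r : ℤ), 0] ![(r : ℤ), 0, (r : ℤ)] := by
  rw [tau_def]
  exact (threePoint_pos r).trans_le (measureReal_mono (Flow.infT_subset_C r))

/-- `τ_{p_c}(b_r, 0) > 0`. -/
theorem tauC_pos (r : ℕ) : 0 < tau 3 (criticalProbI 3) ![(r : ℤ), 0, (r : ℤ)] 0 := by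
  rw [tau_comm, tau_def]
  exact (threePoint_pos r).trans_le (measureReal_mono Set.inter_subset_right)

/-- The denominator `τ(0,a_r) τ(a_r,b_r) τ(b_r,0)` is positive at `p_c`. -/
theorem denom_pos (r : ℕ) :
    0 < tau 3 (criticalProbI 3) 0 ![(r : ℤ), (r : ℤ), 0] *
      tau 3 (criticalProbI 3) ![(r : ℤ), (r : ℤ), 0] ![(r : ℤ), 0, (r : ℤ)] *
      tau 3 (criticalProbI 3) ![(r : ℤ), 0, (r : ℤ)] 0 :=
  mul_pos (mul_pos (tauA_pos r) (tauB_pos r)) (tauC_pos r)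

end Split

/-! ### The crux as a statement about `critRatioSq` -/

/-- The crux holds iff `R_r(p_c)² ≥ 1 + δ` for some `δ > 0` and all large `r`. -/
theorem EquilateralAntiFactorisation_iff_critRatioSq :
    EquilateralAntiFactorisation ↔ ∃ δ : ℝ, 0 < δ ∧ ∃ r₀ : ℕ, ∀ r : ℕ, r₀ ≤ r → 1 + δ ≤ critRatioSq r := by
  unfold EquilateralAntiFactorisation critRatioSq
  refine exists_congr fun δ => and_congr_right fun _ => exists_congr fun r₀ =>
    forall_congr' fun r => forall_congr' fun _ => ?_
  rw [le_div_iff₀ (Split.denom_pos r)]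
  constructor
  · intro h; linarith [h]
  · intro h; linarith [h]

/-- The crux implies `NonSaturation`. -/
theorem nonSaturation_of_EquilateralAntiFactorisation (h : EquilateralAntiFactorisation) :
    NonSaturation := by
  rw [EquilateralAntiFactorisation_iff_critRatioSq] at h
  obtain ⟨δ, hδ, r₀, hr⟩ := h
  intro hlim
  obtain ⟨r₁, hr₁⟩ := eventually_atTop.1 (hlim.eventually_lt_const (by linarith : (1 : ℝ) < 1 + δ))
  have h1 := hr (max r₀ r₁) (le_max_left _ _)
  have h2 := hr₁ (max r₀ r₁) (le_max_right _ _)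
  linarith

/-- **Glue of the split.** `ThreePointAmplitudeLimit → NonSaturation → EquilateralAntiFactorisation`:
if `R_r(p_c)² → ρ` with `ρ ≥ 1` and the limit is not `1`, then `ρ > 1` and
`R_r(p_c)² ≥ 1 + (ρ−1)/2` for all large `r`. -/
theorem EquilateralAntiFactorisation_of_subs (hL : ThreePointAmplitudeLimit) (hN : NonSaturation) :
    EquilateralAntiFactorisation := by
  obtain ⟨ρ, hρ1, hlim⟩ := hL
  have hρne : ρ ≠ 1 := by
    intro hρ
    rw [hρ] at hlim
    exact hN hlim
  have hρ : 1 < ρ := lt_of_le_of_ne hρ1 (Ne.symm hρne)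
  rw [EquilateralAntiFactorisation_iff_critRatioSq]
  obtain ⟨r₀, hr₀⟩ := eventually_atTop.1
    (hlim.eventually_const_lt (by linarith : 1 + (ρ - 1) / 2 < ρ))
  exact ⟨(ρ - 1) / 2, by linarith, r₀, fun r hr => (hr₀ r hr).le⟩

/-- The same glue with the two children written out over `Literature` declarations only (the form
in which they can be filed as route items). -/
theorem EquilateralAntiFactorisation_of_subs'
    (hL : ∃ ρ : ℝ, 1 ≤ ρ ∧ Filter.Tendsto (fun r : ℕ =>
      (Literature.Probability.Percolation.bondPercolation (Literature.Probability.LatticeModels.zdGraph 3)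
          (Literature.Probability.Percolation.criticalProbI 3)).real
          (Literature.Probability.Percolation.openConn 0 ![(r : ℤ), (r : ℤ), 0] ∩
            Literature.Probability.Percolation.openConn 0 ![(r : ℤ), 0, (r : ℤ)]) ^ 2 /
        (Literature.Probability.Percolation.tau 3 (Literature.Probability.Percolation.criticalProbI 3) 0
            ![(r : ℤ), (r : ℤ), 0] *
          Literature.Probability.Percolation.tau 3 (Literature.Probability.Percolation.criticalProbI 3)
            ![(r : ℤ), (r : ℤ), 0] ![(r : ℤ), 0, (r : ℤ)] *
          Literature.Probability.Percolation.tau 3 (Literature.Probability.Percolation.criticalProbI 3)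
            ![(r : ℤ), 0, (r : ℤ)] 0)) Filter.atTop (nhds ρ))
    (hN : ¬ Filter.Tendsto (fun r : ℕ =>
      (Literature.Probability.Percolation.bondPercolation (Literature.Probability.LatticeModels.zdGraph 3)
          (Literature.Probability.Percolation.criticalProbI 3)).real
          (Literature.Probability.Percolation.openConn 0 ![(r : ℤ), (r : ℤ), 0] ∩
            Literature.Probability.Percolation.openConn 0 ![(r : ℤ), 0, (r : ℤ)]) ^ 2 /
        (Literature.Probability.Percolation.tau 3 (Literature.Probability.Percolation.criticalProbI 3) 0
            ![(r : ℤ), (r : ℤ), 0] *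
          Literature.Probability.Percolation.tau 3 (Literature.Probability.Percolation.criticalProbI 3)
            ![(r : ℤ), (r : ℤ), 0] ![(r : ℤ), 0, (r : ℤ)] *
          Literature.Probability.Percolation.tau 3 (Literature.Probability.Percolation.criticalProbI 3)
            ![(r : ℤ), 0, (r : ℤ)] 0)) Filter.atTop (nhds 1)) :
    Summit.CriticalPhenomena.PercolationContinuityZ3.Theses.PercTreeValue.EquilateralAntiFactorisation :=
  EquilateralAntiFactorisation_of_subs hL hN

/-! ### What the route needs: `NonSaturation` alone closes the conjunct -/

/-- **Saturation in a jump world.** If `θ(p_c) ≠ 0` then `R_r(p_c)² → 1`: pattern-blindness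
(`Anchor.tendsto_threePoint/tauA/tauB/tauC`, valid at every `p`) at `p = p_c` with `θ(p_c) > 0`. -/
theorem tendsto_critRatioSq_of_theta_ne_zero
    (hθ : theta (zdGraph 3) (0 : Site 3) (criticalProbI 3) ≠ 0) :
    Tendsto critRatioSq atTop (𝓝 1) := by
  have hθnn : 0 ≤ theta (zdGraph 3) (0 : Site 3) (criticalProbI 3) := by
    unfold theta
    exact measureReal_nonneg
  have hθpos : 0 < theta (zdGraph 3) (0 : Site 3) (criticalProbI 3) := lt_of_le_of_ne hθnn (Ne.symm hθ)
  have hden : theta (zdGraph 3) (0 : Site 3) (criticalProbI 3) ^ 2 *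
      theta (zdGraph 3) (0 : Site 3) (criticalProbI 3) ^ 2 *
      theta (zdGraph 3) (0 : Site 3) (criticalProbI 3) ^ 2 ≠ 0 := by positivity
  have hval : (theta (zdGraph 3) (0 : Site 3) (criticalProbI 3) ^ 3) ^ 2 /
      (theta (zdGraph 3) (0 : Site 3) (criticalProbI 3) ^ 2 *
        theta (zdGraph 3) (0 : Site 3) (criticalProbI 3) ^ 2 *
        theta (zdGraph 3) (0 : Site 3) (criticalProbI 3) ^ 2) = 1 := by
    rw [div_eq_one_iff_eq hden]
    ring
  have h := ((Anchor.tendsto_threePoint (criticalProbI 3)).pow 2).div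
    (((Anchor.tendsto_tauA (criticalProbI 3)).mul (Anchor.tendsto_tauB (criticalProbI 3))).mul
      (Anchor.tendsto_tauC (criticalProbI 3))) hden
  rw [hval] at h
  exact h

/-- **`NonSaturation` suffices for the conjunct.** If the critical three-point amplitude of `ℤ³`
does not converge to `1`, then `θ(p_c) = 0` on `ℤ³`. -/
theorem percolationContinuityZ3_of_nonSaturation (hN : NonSaturation) : _root_.PercolationContinuityZ3 := by
  refine Literature.Probability.Percolation.percolationContinuityZ3_iff.mpr ?_
  by_contra hne
  exact hN (tendsto_critRatioSq_of_theta_ne_zero hne)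

/-- In a jump world the jump-consistent child holds trivially (`ρ = 1`): it carries none of the
conjunct-strength. -/
theorem threePointAmplitudeLimit_of_theta_ne_zero
    (hθ : theta (zdGraph 3) (0 : Site 3) (criticalProbI 3) ≠ 0) : ThreePointAmplitudeLimit :=
  ⟨1, le_rfl, tendsto_critRatioSq_of_theta_ne_zero hθ⟩

/-- Log form: `Flow.infLogRatio r p_c = log (critRatioSq r)`, linking the split to the landed flow
certificate (`EquilateralAntiFactorisation_iff_infLogRatio`). -/
theorem infLogRatio_pc_eq_log_critRatioSq (r : ℕ) :
    Flow.infLogRatio r (criticalProbI 3 : ℝ) = Real.log (critRatioSq r) :=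
  Flow.infLogRatio_coe (criticalProbI 3) Flow.pc_pos r

end Summit.CriticalPhenomena.PercolationContinuityZ3.Theorems.EquilateralAntiFactorisation

end
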